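import Summits.QuantumAdvantage.QuantumAdvantage.Theorems.AvgFaceBeyondPrior.Negative.AvgFaceBeyondPriorNecessary
import Summits.QuantumAdvantage.QuantumAdvantage.Theorems.ArithStatLadderAcZeroRungDefs
import Summits.QuantumAdvantage.QuantumAdvantage.Theorems.AvgFaceBeyondPrior.Negative.AvgFaceBeyondPriorBlocks
import Literature.NumberTheory.QuadraticFields.ThreeTorsion
import Literature.Computability.Complexity.BPPErrorReduction

/-!
# Crux `ArithStatLadder.IqThreeNotBPP` (stmt-QuantumAdvantage-14864): the correlation dial implies the crux

Card `correlation-dial` of the line `Sketch` (planner sketch `Cruxes/IqThreeNotBPP/SketchIdeator2-source.md`,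
§1, there kernel-checked; landed here with `tw ↦ tauC` = the ladder's centred statistic of
`ArithStatLadderAcZeroRungDefs.lean`, and with the card's objects `acc`/`corrSum`/`absSum`/`CorrBelow`/`PPTRung`
written out — no new definition), supports for the crux registered as the sub-goals `stub_dialCorrBelow`,
`stub_dialPPTRung`:

* `tauC_cases` — exactness dichotomy on the block: for `d ∈ 𝒟_n`, either `d ∈ IQ3` and `τ(d) − 2 ≥ 1`,
  or `d ∉ IQ3` and `τ(d) − 2 = −1` (Cauchy in `Cl(𝓞_K)` + `h(d_K) = h_K`, all PROVED in the tree: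
  `three_dvd_classNumber_iff_one_lt_quadFieldThreeTorsion`);
* `stub_dialCorrBelow` — **every point `c < 1` of the dial implies the crux**, with NO arithmetic
  input: a `BPP` machine with error `ε = (1 − c)/4` (`exists_randAlg_error_le_of_mem_BPP_holds`) is a PPT
  statistic whose `±`-version has correlation `≥ (1 − 2ε)·Σ|τ−2| > c·Σ|τ−2|` at every level `n ≥ 2`;
* `stub_dialPPTRung` — **the uniform apex of the ladder implies the crux** (via the point `c = 1/2` of the
  dial; the window mean comes out of the apex itself: rung zero = Davenport–Heilbronn on dyadic windows), density-free,
  Davenport–Heilbronn-free, advice-free (contrast: `PPolyRung ⇒ IqThreeNotPPoly` needs non-uniformity,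
  `AvgFaceBeyondPrior` needs the density floor).

CONDITIONAL theorems on the route decl by name (hypotheses = the dial point / the apex, hypothesis-type,
written out). Theorems only; sorry-free.
-/

set_option linter.dupNamespace false -- D-0017: single-problem summit ⇒ `QuantumAdvantage.QuantumAdvantage` by design

noncomputable section

namespace Summit.QuantumAdvantage.QuantumAdvantage.Theorems.IqThreeNotBPP

open scoped BigOperators Classical
open Filter Finset
open _root_.Computability Literature.Computability.Complexity Literature.Computability.MetaComplexity
open Literature.NumberTheory.QuadraticFields
open Summit.QuantumAdvantage.QuantumAdvantage.Theses.ArithStatLadder (IqThreeNotBPP)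
open Summit.QuantumAdvantage.QuantumAdvantage.Theorems.AvgFaceBeyondPrior.Negative
open Summit.QuantumAdvantage.QuantumAdvantage.Theorems.AcZeroRung (tauC)

/-- Indicator of a member. [folklore] -/
theorem boolIndicator_of_mem {s : Set (List Bool)} {x : List Bool} (h : x ∈ s) :
    s.boolIndicator x = true := by
  unfold Set.boolIndicator; exact if_pos h

/-- Indicator of a non-member. [folklore] -/
theorem boolIndicator_of_not_mem {s : Set (List Bool)} {x : List Bool} (h : x ∉ s) :
    s.boolIndicator x = false := by
  unfold Set.boolIndicator; exact if_neg h

/-- **Exactness dichotomy on the block**: for `d ∈ 𝒟_n`, either `d ∈ IQ3` and `t − 2 ≥ 1`, or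
`d ∉ IQ3` and `t − 2 = −1`. (Cauchy in `Cl(𝓞_K)` + form/ideal class number, all PROVED in the tree.) [folklore] -/
theorem tauC_cases {n d : ℕ} (hd : d ∈ fundBlock n) :
    (d ∈ iq3Set ∧ 1 ≤ tauC d) ∨ (d ∉ iq3Set ∧ tauC d = -1) := by
  simp only [fundBlock, Finset.mem_filter, Finset.mem_Ico] at hd
  obtain ⟨⟨hlo, -⟩, hfund⟩ := hd
  have hdpos : 0 < d := lt_of_lt_of_le (Nat.one_le_two_pow) hlo
  have hD0 : (-(d:ℤ)) < 0 := by omega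
  have hpos := quadFieldThreeTorsion_pos (-(d:ℤ))
  by_cases h3 : 3 ∣ BinaryQuadraticForm.classNumber (-(d:ℤ))
  · left
    refine ⟨⟨hfund, h3⟩, ?_⟩
    have hlt : 1 < quadFieldThreeTorsion (-(d:ℤ)) :=
      (three_dvd_classNumber_iff_one_lt_quadFieldThreeTorsion hfund hD0).1 h3
    obtain ⟨r, hr⟩ := exists_quadFieldThreeTorsion_eq_pow (-(d:ℤ))
    have hr0 : r ≠ 0 := by
      rintro rfl
      rw [hr, pow_zero] at hlt
      exact lt_irrefl _ hlt
    have h3le : 3 ≤ quadFieldThreeTorsion (-(d:ℤ)) := by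
      rw [hr]
      calc (3:ℕ) = 3 ^ 1 := by norm_num
        _ ≤ 3 ^ r := Nat.pow_le_pow_right (by norm_num) (Nat.one_le_iff_ne_zero.2 hr0)
    have : (3:ℝ) ≤ (quadFieldThreeTorsion (-(d:ℤ)) : ℝ) := by exact_mod_cast h3le
    unfold tauC
    linarith
  · right
    refine ⟨fun h => h3 h.2, ?_⟩
    have hle : quadFieldThreeTorsion (-(d:ℤ)) ≤ 1 := by
      by_contra h
      exact h3 ((three_dvd_classNumber_iff_one_lt_quadFieldThreeTorsion hfund hD0).2 (by omega))
    have h1 : quadFieldThreeTorsion (-(d:ℤ)) = 1 := le_antisymm hle hpos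
    unfold tauC
    rw [h1]
    norm_num

/-- `|t − 2| ≥ 1` on the block. [folklore] -/
theorem one_le_abs_tauC {n d : ℕ} (hd : d ∈ fundBlock n) : 1 ≤ |tauC d| := by
  rcases tauC_cases hd with ⟨-, h⟩ | ⟨-, h⟩
  · rw [abs_of_pos (by linarith)]; exact h
  · rw [h]; norm_num

/-- `#𝒟_n ≤ Σ_{𝒟_n} |τ − 2|`. [folklore] -/
theorem card_le_sum_abs_tauC (n : ℕ) :
    ((fundBlock n).card : ℝ) ≤ ∑ d ∈ fundBlock n, |tauC d| := by
  calc ((fundBlock n).card : ℝ) = ∑ d ∈ fundBlock n, (1:ℝ) := by simp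
    _ ≤ ∑ d ∈ fundBlock n, |tauC d| := Finset.sum_le_sum fun d hd => one_le_abs_tauC hd

/-- The blocks are nonempty from `n = 2` (tree, `Blocks.fundBlock_nonempty`), so the normalizer
`Σ_{𝒟_n} |τ − 2|` is positive. [folklore] -/
theorem sum_abs_tauC_pos {n : ℕ} (hn : 2 ≤ n) : 0 < ∑ d ∈ fundBlock n, |tauC d| := by
  have hne : (fundBlock n).Nonempty := Blocks.fundBlock_nonempty hn
  exact Finset.sum_pos (fun d hd => lt_of_lt_of_le one_pos (one_le_abs_tauC hd)) hne

/-- **STUB · `stub_dialCorrBelow` — every point `c < 1` of the correlation dial implies the crux**, with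
no arithmetic input: a `BPP` machine for IQ3 with error `ε = (1 − c)/4`
(`exists_randAlg_error_le_of_mem_BPP_holds`) is a PPT statistic whose `±`-version has correlation
`≥ (1 − 2ε)·Σ|τ−2| > c·Σ|τ−2|` at EVERY level `n ≥ 2` (`tauC_cases`); contradiction with the dial at
some level `n ≥ 2` (`Frequently.and_eventually`). Hypothesis-type antecedent (the dial point `c`).
[cite: AroraBarakCC2009, §7.4.1] -/
theorem stub_dialCorrBelow :
    ∀ c : ℝ, c < 1 →
      (∀ A : RandAlg (List Bool) Bool, A.IsPolyTime id encodeBool →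
        ∃ᶠ n in atTop,
          ∑ d ∈ fundBlock n, tauC d * (2 * A.pr id (encodeNat d) {true} - 1) <
            c * ∑ d ∈ fundBlock n, |tauC d|) →
      IqThreeNotBPP := by
  intro c hc h hBPP
  have hBPP' : iq3Lang ∈ BPP := hBPP
  set ε : ℝ := (1 - c) / 4 with hε
  have hε0 : 0 < ε := by rw [hε]; linarith
  obtain ⟨A, hA, -, hgood⟩ := exists_randAlg_error_le_of_mem_BPP_holds hBPP' ε hε0
  obtain ⟨n, hlt, hn⟩ := ((h A hA).and_eventually (eventually_ge_atTop 2)).exists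
  have key : ∀ d ∈ fundBlock n,
      (1 - 2 * ε) * |tauC d| ≤ tauC d * (2 * A.pr id (encodeNat d) {true} - 1) := by
    intro d hd
    rcases tauC_cases hd with ⟨hmem, htw⟩ | ⟨hmem, htw⟩
    · have hind : iq3Lang.boolIndicator (encodeNat d) = true :=
        boolIndicator_of_mem ((encodeNat_mem_iq3Lang d).2 hmem)
      have hacc : 1 - ε ≤ A.pr id (encodeNat d) {true} := by
        have := hgood (encodeNat d)
        rw [hind] at this
        exact this
      rw [abs_of_pos (by linarith)]
      nlinarith [mul_nonneg (sub_nonneg.2 htw) (sub_nonneg.2 hacc)]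
    · have hind : iq3Lang.boolIndicator (encodeNat d) = false :=
        boolIndicator_of_not_mem fun h' => hmem ((encodeNat_mem_iq3Lang d).1 h')
      have hfalse : 1 - ε ≤ A.pr id (encodeNat d) {false} := by
        have := hgood (encodeNat d)
        rw [hind] at this
        exact this
      have hacc : A.pr id (encodeNat d) {true} ≤ ε := by
        have h1 := RandAlg.pr_ne_eq_one_sub A id (encodeNat d) false
        have hset : ({b : Bool | b ≠ false} : Set Bool) = {true} := by
          ext b; cases b <;> simp
        rw [hset] at h1
        linarith
      rw [htw, abs_neg, abs_one]
      linarith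
  have hsum : (1 - 2 * ε) * ∑ d ∈ fundBlock n, |tauC d| ≤
      ∑ d ∈ fundBlock n, tauC d * (2 * A.pr id (encodeNat d) {true} - 1) := by
    rw [Finset.mul_sum]
    exact Finset.sum_le_sum key
  have hpos : 0 < ∑ d ∈ fundBlock n, |tauC d| := sum_abs_tauC_pos hn
  have h12 : c < 1 - 2 * ε := by rw [hε]; linarith
  have hlt' : (1 - 2 * ε) * ∑ d ∈ fundBlock n, |tauC d| < c * ∑ d ∈ fundBlock n, |tauC d| :=
    lt_of_le_of_lt hsum hlt
  have : c * ∑ d ∈ fundBlock n, |tauC d| < (1 - 2 * ε) * ∑ d ∈ fundBlock n, |tauC d| :=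
    mul_lt_mul_of_pos_right h12 hpos
  linarith

/-- The constant-`true` statistic is PPT. [folklore] -/
theorem isPolyTime_constTrue :
    (RandAlg.ofDet (fun _ : List Bool => true)).IsPolyTime id encodeBool :=
  RandAlg.IsPolyTime.ofDet_holds (PolyTimeComputable.const id encodeBool true)

/-- The constant-`true` statistic accepts with probability `1`. [folklore] -/
theorem pr_constTrue (d : ℕ) : (RandAlg.ofDet fun _ : List Bool => true).pr id (encodeNat d) {true} = 1 := by
  rw [RandAlg.pr_ofDet]
  simp

/-- **STUB · `stub_dialPPTRung` — the UNIFORM APEX of the ladder implies the crux**, density-free,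
Davenport–Heilbronn-free, advice-free: the apex tested on the constant statistic gives the window mean
`Σ_{𝒟_n} (τ − 2) = o(#𝒟_n)` (rung zero), hence the point `c = 1/2` of the dial
(`Σ(τ−2)(2·acc − 1) = 2·Σ(τ−2)·acc − Σ(τ−2) ≤ 3·#𝒟_n/8 < ½·Σ|τ−2|`), hence the crux
(`stub_dialCorrBelow`). Hypothesis-type antecedent (the apex `PPTRung`, written out).
[cite: AroraBarakCC2009, §7.4.1] -/
theorem stub_dialPPTRung :
    (∀ A : RandAlg (List Bool) Bool, A.IsPolyTime id encodeBool → ∀ ε : ℝ, 0 < ε →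
      ∀ᶠ n in atTop, |∑ d ∈ fundBlock n, tauC d * A.pr id (encodeNat d) {true}| ≤
        ε * ((fundBlock n).card : ℝ)) →
      IqThreeNotBPP := by
  intro h
  refine stub_dialCorrBelow (1 / 2) (by norm_num) fun A hA => ?_
  have h1 := h A hA (1 / 8) (by norm_num)
  have h2 : ∀ᶠ n in atTop, |∑ d ∈ fundBlock n, tauC d| ≤ 1 / 8 * ((fundBlock n).card : ℝ) := by
    filter_upwards [h _ isPolyTime_constTrue (1 / 8) (by norm_num)] with n hn
    simpa only [pr_constTrue, mul_one] using hn
  have h3 : ∀ᶠ n in atTop,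
      ∑ d ∈ fundBlock n, tauC d * (2 * A.pr id (encodeNat d) {true} - 1) <
        1 / 2 * ∑ d ∈ fundBlock n, |tauC d| := by
    filter_upwards [h1, h2, eventually_ge_atTop 2] with n h1 h2 hn
    have hexp : ∑ d ∈ fundBlock n, tauC d * (2 * A.pr id (encodeNat d) {true} - 1) =
        2 * (∑ d ∈ fundBlock n, tauC d * A.pr id (encodeNat d) {true}) -
          ∑ d ∈ fundBlock n, tauC d := by
      rw [Finset.mul_sum, ← Finset.sum_sub_distrib]
      exact Finset.sum_congr rfl fun d _ => by ring
    have hcard := card_le_sum_abs_tauC n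
    have hpos := sum_abs_tauC_pos hn
    have e1 := le_abs_self (∑ d ∈ fundBlock n, tauC d * A.pr id (encodeNat d) {true})
    have e2 := neg_le_abs (∑ d ∈ fundBlock n, tauC d)
    rw [hexp]
    linarith
  exact h3.frequently

end Summit.QuantumAdvantage.QuantumAdvantage.Theorems.IqThreeNotBPP

end
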